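import Summits.QuantumFields.YangMills.Theses.UnitScaleTilt
import Literature.MathematicalPhysics.QuantumFieldTheory.Balaban1983to89.T3PrintedRegularMinimiser
import Literature.MathematicalPhysics.QuantumFieldTheory.Balaban1983to89.T3SmallLiftHistory
import Literature.MathematicalPhysics.QuantumFieldTheory.Balaban1983to89.T3AlphaInputsACTwoRun
import Summits.QuantumFields.YangMills.Theorems.UnitScaleTiltFluctuationComparisonRegPrOneStepSubmersion
import Summits.QuantumFields.YangMills.Theorems.UnitScaleTiltFluctuationComparisonRegPrSocket
import Summits.QuantumFields.YangMills.Theorems.AlphaInputsT3AC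
import Summits.QuantumFields.YangMills.Theorems.AlphaInputsT3ACv2Rec
import Summits.QuantumFields.YangMills.Theorems.UnitScaleTiltFluctuationComparisonRegPrLevelCauchyMin
import HarnessLib

/-!
# BC3 birth skeleton v5h — OWNER CUT for the NEW load-bearing item `FluctuationComparisonRegPrL` (stmt-QuantumFields-19935)
# (route owner ym3-torus-plan g17, 2026-08-27; OWNER RULING g17-№1 §C; ERRATUM v3′ «for all sufficiently large (b₀,p₀)», route rev 6–9)

= ★ym-ust-19201-p2 g2's v5g PROPOSAL (211430dd17819b1d, evidence #49 on the aside item stmt-QuantumFields-19201) ACCEPTED IN SUBSTANCE — four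
stubs, the α-adapter PACKAGE-FREE (`RepAtHeights ∧ PintDecomp ∧ TwoRunMin`), S-E″ = the landed `LogComparisonLevelCauchyMin.levelCauchyOfTwoRunMin_dec`
(p479478), e1 folded (finding #47), positivity from STUB 1 + landed submersion — and RE-CUT for the owner finding F-owner-g17-1 ((b₀,p₀)-EXACTNESS:
a run with constants record `𝔠` serves the profile (b₀,p₀) iff its p-function IS `θBal F.L γ b₀ p₀`; print and the Balaban3D lane run only for
«b₀ a sufficiently large absolute constant, p₀ > 2», [Balaban1985UV3] (7) p.257; lane `AlphaConsts.p₀ = 2r₀+1 ≥ 3`, `AlphaConsts.b₀ ≥ √448`):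
* STUB 2′ `stub_laneRecords` (replaces v5g's `stub_laneInputsT3`, ONE record per L is not enough) := ★alpha-1's LANDED record-parametric closed Prop
  `Theorems.AlphaInputsT3ACv2Rec L` BY NAME (p481577): for every odd L > 1 there are thresholds (b₁,p₁) such that EVERY profile (b₀,p₀) ⪰ (b₁,p₁) is the
  (b₀,p₀) of some constants record 𝔠, with [Balaban1985Variational] constants a₀ a₁ bound WITH the record (F-α1-8: «depend on d and L only»), whose v2 (α)
  rows `AlphaInputsT3AC.OfV2At F 𝔠 a₀ a₁` hold for every family of block size L (shared verbatim with the 19936 skeleton; one discharge serves both lines).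
* STUB 3′ `stub_alphaTwoRunOfLane`: v5g's text with «∀ (b₀ p₀ : ℝ), 0 < b₀ → 2 < p₀ →» DELETED, the conclusion read at the record's OWN constants
  `𝔠.b₀ 𝔠.p₀` (the v5g order «∀ 𝔠 … ∀ b₀ p₀» is undischargeable: instance p₀ := 𝔠.p₀ + 7), and the α-hypothesis re-pointed to the v2 rows AT GIVEN
  constants `AlphaInputsT3AC.OfV2At F (hF ▸ 𝔠) a₀ a₁` (so the adapter may take ε₁ := a₀, family-uniform — ★alpha-1 01:18:27Z).
* STUB 4′ `stub_logComparisonSmallBlocks` (odd L < 7 residue): threshold form, thresholds FIRST (then (b₀,p₀), ε₁, m₀, γ₁), body byte-identical.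
* STUB 1, `landed_oneStepSubmersion`, `landed_levelCauchyOfTwoRunMin`, `posOnSmall`: byte-identical to v5g.
* §2 concludes `Summit.QuantumFields.YangMills.Theses.UnitScaleTilt.FluctuationComparisonRegPrL` BY NAME (`FluctuationComparisonRegPrL_of`): thresholds :=
  those of STUB 2′ (L ≥ 7) / STUB 4′ (L < 7); for L ≥ 7 the record with (𝔠.b₀, 𝔠.p₀) = (b₀,p₀) is obtained and `subst`ituted, STUB 3′ gives ε₁(𝔠), a(𝔠),
  the landed S-E″ gives m₀ — ε₁ and m₀ may depend on the record, which the v3′ quantifier order (thresholds first) allows.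
Sorries ONLY in the four `stub_*`.  [cite: Balaban1985UV3, Thm 2 p.272 and (7) p.257; King1986, Prop. 3.8-3.9 pp.664-665, Thm 3.4 (3.9) p.656]
-/

set_option autoImplicit false

noncomputable section

namespace Summit.QuantumFields.YangMills.Cruxes.FluctuationComparisonRegPrL.BirthV5h

open MeasureTheory Filter Topology
open Literature.MathematicalPhysics.QuantumFieldTheory.Balaban1983to89
open Literature.MathematicalPhysics.QuantumFieldTheory.Balaban1983to89.T3ContinuumYM3Torus
open Literature.MathematicalPhysics.QuantumFieldTheory.Balaban1983to89.T3LevelShift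
open Literature.MathematicalPhysics.QuantumFieldTheory.Balaban1983to89.T3UnitLawDensityEML (ℰp measurableE_ℰp)
open Literature.MathematicalPhysics.QuantumFieldTheory.Balaban1983to89.T3UnitScaleTilt
open Literature.MathematicalPhysics.QuantumFieldTheory.Balaban1983to89.T3RestrictedUnitDensity
open Literature.MathematicalPhysics.QuantumFieldTheory.Balaban1983to89.T3TiltDescent
open Literature.MathematicalPhysics.QuantumFieldTheory.Balaban1983to89.T3ConstrainedMinimiser
open Literature.MathematicalPhysics.QuantumFieldTheory.Balaban1983to89.T3RegularMinimiser
open Literature.MathematicalPhysics.QuantumFieldTheory.Balaban1983to89.T3PrintedRegularMinimiser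
open Literature.MathematicalPhysics.QuantumFieldTheory.Balaban1983to89.T3SmallLiftHistory
open Literature.MathematicalPhysics.QuantumFieldTheory.Balaban1983to89.T3LogComparisonSocket
open Literature.MathematicalPhysics.QuantumFieldTheory.Balaban1983to89.T3AlphaInputsAC
open Literature.MathematicalPhysics.QuantumFieldTheory.Balaban1983to89.T3AlphaInputsACTwoRun
open Literature.MathematicalPhysics.QuantumFieldTheory.Balaban1983to89.T3AlphaInputsACTwoRunLevel
open Literature.MathematicalPhysics.QuantumFieldTheory.Balaban1983to89.Missing
open Literature.MathematicalPhysics.QuantumFieldTheory.Balaban1983to89.T4Continuum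

/-! ## §1 Registered stubs (sorries live ONLY here) -/

/-- STUB 1 (L; W7) — ONE-STEP SMALL LIFT with gain `κ√L ≤ 1` for every family of block size `L` (linearisation certified; non-linear step =
implicit function on `SU(2)^{bonds}`). [cite: Balaban1987RG1, (0.4)/(0.18) p.253] -/
theorem stub_oneStepSmallLift :
    ∀ L : ℕ, ∃ κ δ₀ : ℝ, κ * Real.sqrt L ≤ 1 ∧ 0 < δ₀ ∧
      ∀ F : T3Family, F.L = L → OneStepSmallLift F ℰp κ δ₀ := by
  sorry

/-- LANDED (was STUB 2 of v3, `stub_oneStepSubmersion`): the ONE-STEP SUBMERSION (O) ∧ (N) of the (0.4)/EML averaging on small `SU(2)`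
fields — PROVED by the fleet lead ym-ust-19201-p1, `Theorems.OneStepSubmersion.oneStepSubmersion_family` (p446430; engines p443878 fibrewise
submersion, p444734/p445163 parametric IFT on `SU(2)` in the cone picture, p445817 analytic datum of the EML fibre map).  Renamed `landed_…` so the
registrar does not resurrect it as a stub (cf. 19200 v3d). [cite: Balaban1987RG1, (0.4) p.253] -/
theorem landed_oneStepSubmersion :
    ∀ L : ℕ, ∃ δ₁ : ℝ, 0 < δ₁ ∧ ∀ F : T3Family, F.L = L → ∀ K j : ℕ, j + 1 ≤ F.m + K →
      (∀ O : Set (GaugeField (F.P K) j (Matrix.specialUnitaryGroup (Fin 2) ℂ)), IsOpen O → O ⊆ {U | PlaqSmall δ₁ U} →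
        IsOpen ((BlockAveraging.blockAvg (P := F.P K) (j := j) ℰp).avg '' O)) ∧
      (∀ O : Set (GaugeField (F.P K) j (Matrix.specialUnitaryGroup (Fin 2) ℂ)), IsOpen O → O ⊆ {U | PlaqSmall δ₁ U} →
        ∀ A : Set (GaugeField (F.P K) (j + 1) (Matrix.specialUnitaryGroup (Fin 2) ℂ)), MeasurableSet A →
          fieldMeasure (F.P K) j (Matrix.specialUnitaryGroup (Fin 2) ℂ)
              (O ∩ (BlockAveraging.blockAvg (P := F.P K) (j := j) ℰp).avg ⁻¹' A) = 0 →
            fieldMeasure (F.P K) (j + 1) (Matrix.specialUnitaryGroup (Fin 2) ℂ)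
              (A ∩ (BlockAveraging.blockAvg (P := F.P K) (j := j) ℰp).avg '' O) = 0) :=
  Summit.QuantumFields.YangMills.Theorems.OneStepSubmersion.oneStepSubmersion_family

/-- STUB 2′ (XXL; owner's `stub_laneRecords`, OWNER RULING g17-№1 §C; IN PRINT modulo Bałaban CMP 95–99/102 = NODE O's object at d = 3, run with the
power-counting profile as a PARAMETER) — BAŁABAN'S (α) INPUT ROWS HOLD FOR THE PINNED CARRIER AT EVERY SUFFICIENTLY LARGE PROFILE: for every admissible
block size there are thresholds `(b₁, p₁)` such that every profile `(b₀, p₀) ⪰ (b₁, p₁)` is the profile of SOME primitive-constants record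
`𝔠 : AlphaConsts L 2` (`𝔠.b₀ = b₀`, `𝔠.p₀ = p₀`) with [7]-constants `a₀ a₁` bound with the record, whose v2 AC (α) rows `AlphaInputsT3AC.OfV2At F 𝔠 a₀ a₁`
hold for every family with `F.L = L` — ★alpha-1's LANDED closed Prop `Theorems.AlphaInputsT3ACv2Rec L` (p481577) BY NAME (ruling §D(3) executed).  SHARED verbatim with
the `HistoryTailL` (stmt-QuantumFields-19936) skeleton. [cite: Balaban1985UV3, Thm 1 p.257, (7) p.257 and Thm 2 p.272] -/
theorem stub_laneRecords :
    ∀ (L : ℕ), Odd L → 1 < L → Summit.QuantumFields.YangMills.Theorems.AlphaInputsT3ACv2Rec L := by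
  sorry

/-- STUB 3′ = α⁺ (XXL, THE CORE; owner's `stub_alphaTwoRunOfLane` AT THE RECORD'S OWN CONSTANTS, OWNER RULING g17-№1 §C; hypothesis `7 ≤ L` =
our typing's consistency range for the socket's full-V-window lower representation `RepAtHeights` (owner ruling g16-№1; odd L ∈ {3, 5} is STUB 4′)):
FROM THE (α) ROWS OF ONE CONSTANTS RECORD `𝔠`, below thresholds `ε₁(L, 𝔠)`, `γ₁(L, 𝔠, ε₀)` and with ONE exponent `a(L, 𝔠) > 0`, every family of that
block size carries a datum `D : AlphaDataT3 F γ` with the two-sided representation at the heights `RepAtHeights D 𝔠.b₀ 𝔠.p₀ ε₀` READ ON THE RECORD'S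
OWN p-FUNCTION `θBal F.L γ 𝔠.b₀ 𝔠.p₀` (Bałaban Thm 2 = (41)∧(47) for the ℰp runs), the (43)-decomposition `PintDecomp D`, and the FOLDED two-run bundle
`TwoRunMin D 𝔠.b₀ 𝔠.p₀ a` (King's matched-step activity replacement at the two runs' own trivial-history minimisers, rate on the level counted from the
cut-off, minimiser closeness included — [King1986] §3.4–3.5, Props 3.8–3.10; located, UNPRINTED for non-abelian d = 3).  v5g's «∀ (b₀ p₀ : ℝ)» is
deleted: a run serves only its own profile (F-owner-g17-1). [cite: Balaban1985UV3, Thm 2 p.272; King1986, Prop. 3.8-3.9 pp.664-665] -/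
theorem stub_alphaTwoRunOfLane :
    ∀ (L : ℕ), Odd L → 7 ≤ L → ∀ (𝔠 : Summit.QuantumFields.Balaban3D.Proofs.Primitives.AlphaConsts L (Summit.QuantumFields.Balaban3D.Carriers.suGroupModel 2).N)
      (a₀ a₁ : ℝ), 0 < a₀ → 0 < a₁ → 𝔠.B₃ * a₁ ≤ a₀ →
      ∃ ε₁ : ℝ, 0 < ε₁ ∧ ∃ a : ℝ, 0 < a ∧ ∀ (ε₀ : ℝ), 0 < ε₀ → ε₀ ≤ ε₁ →
        ∃ γ₁ : ℝ, 0 < γ₁ ∧ ∀ (F : T3Family) (γ : ℝ) (hF : F.L = L), 0 < γ → γ ≤ γ₁ →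
          Summit.QuantumFields.YangMills.Theorems.AlphaInputsT3AC.OfV2At F (hF ▸ 𝔠) a₀ a₁ →
            ∃ D : AlphaDataT3 F γ, RepAtHeights D 𝔠.b₀ 𝔠.p₀ ε₀ ∧ PintDecomp D ∧ TwoRunMin D 𝔠.b₀ 𝔠.p₀ a := by
  sorry

/-- LANDED (was STUB S-E″ `stub_levelCauchyOfSchemas` of v5c/v5d + STUB e1 `stub_minimiserCauchy`; v5g THEOREM, renamed `landed_…` so the registrar does not resurrect it
as a stub): for EVERY exponent `a > 0`, with `m₀ = ⌈(3+b)/b⌉ + 1`, `b = min(a, 1)` and NO real threshold (`ε₁ = γ₁ = 1`): the (43)-decomposition `PintDecomp D` and the folded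
two-run bundle `TwoRunMin D b₀ p₀ a` give the cut-off-Cauchy property `CauchyAtHeights D b₀ p₀ m` — PURE COUNTING (`LogComparisonLevelCauchyMin.levelCauchyOfTwoRunMin_dec`,
appended to p479105). [cite: King1986, Thm 3.4 (3.9) p.656 and (3.12)-(3.13) p.657] -/
theorem landed_levelCauchyOfTwoRunMin :
    ∀ (L : ℕ), Odd L → 1 < L → ∀ (a : ℝ), 0 < a →
      ∃ ε₁ : ℝ, 0 < ε₁ ∧ ∀ (ε₀ : ℝ), 0 < ε₀ → ε₀ ≤ ε₁ → ∃ m₀ : ℕ, ∀ (m : ℕ), m₀ ≤ m → ∀ (b₀ p₀ : ℝ), 0 < b₀ → 2 < p₀ →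
        ∃ γ₁ : ℝ, 0 < γ₁ ∧ ∀ (F : T3Family) (γ : ℝ), F.L = L → 0 < γ → γ ≤ γ₁ →
          ∀ (D : AlphaDataT3 F γ), PintDecomp D → TwoRunMin D b₀ p₀ a → CauchyAtHeights D b₀ p₀ m :=
  Summit.QuantumFields.YangMills.Theorems.LogComparisonLevelCauchyMin.levelCauchyOfTwoRunMin_dec

/-- STUB 4′ — SMALL-BLOCK SUPPLEMENT (rank-last; XL; located-UNPRINTED; owner rulings g16-№1 / g17-№1): the v2–v4 registered STUB-3 body ON odd
`L < 7`, i.e. L ∈ {3, 5} (the block sizes at which the large-L line cannot run AS TYPED — socket window edge band, FINDING #44/#56 on 19201), in the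
ERRATUM-v3′ THRESHOLD FORM: thresholds `(b₁, p₁)` FIRST, then the profile, then `ε₁, m₀, γ₁`.  Line foreseen: (R1) print's χ back / (R2′) shrunken
window inside the proof / (R0) height guard — see the v5d docstring on the aside item; not staffed before the large-L chain closes.
[cite: Balaban1985UV3, (47) p.267; King1986, Thm 3.4 (3.9) p.656] -/
theorem stub_logComparisonSmallBlocks :
    ∀ (L : ℕ), Odd L → 1 < L → L < 7 → ∃ (b₁ p₁ : ℝ), ∀ (b₀ p₀ : ℝ), b₁ ≤ b₀ → p₁ ≤ p₀ → 0 < b₀ → 2 < p₀ →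
      ∃ ε₁ : ℝ, 0 < ε₁ ∧ ∀ (ε₀ : ℝ), 0 < ε₀ → ε₀ ≤ ε₁ → ∃ m₀ : ℕ, ∀ (m : ℕ), m₀ ≤ m →
        ∃ γ₁ : ℝ, 0 < γ₁ ∧ ∀ (F : T3Family) (γ : ℝ), F.L = L → 0 < γ → γ ≤ γ₁ →
          ∃ (r κ : ℕ → ℝ), Summable r ∧ (∀ K, 0 ≤ r K) ∧
            ∀ K, ∀ᵐ V ∂fieldMeasure (F.P (K / m)) 0 (Matrix.specialUnitaryGroup (Fin 2) ℂ),
              PlaqSmall (θBal F.L γ b₀ p₀ (K / m)) V →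
                0 < heightDensity F γ (Nat.div_le_self K m) (histGood F ℰp (θBal F.L γ b₀ p₀) K (K / m)) V →
                0 < heightDensity F γ ((Nat.div_le_self K m).trans (Nat.le_succ K))
                      (histGood F ℰp (θBal F.L γ b₀ p₀) (K + 1) (K / m)) V →
                  |(Real.log (heightDensity F γ ((Nat.div_le_self K m).trans (Nat.le_succ K))
                        (histGood F ℰp (θBal F.L γ b₀ p₀) (K + 1) (K / m)) V) + bgRegPr' F γ m ε₀ K V) -
                    (Real.log (heightDensity F γ (Nat.div_le_self K m) (histGood F ℰp (θBal F.L γ b₀ p₀) K (K / m)) V) + bgRegPr F γ m ε₀ K V) -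
                      κ K| ≤ r K := by
  sorry

/-! ## §2 The composition — NO sorry below this line -/

/-- The two-run log-comparison in the v3′ order (thresholds first): for each odd `L > 1` — L ≥ 7: thresholds from STUB 2′; for a profile beyond them the
record `𝔠` with `(𝔠.b₀, 𝔠.p₀) = (b₀, p₀)`; `ε₁(𝔠), a(𝔠)` from STUB 3′; `m₀` from the landed S-E″ at `a`; per family the datum `D`, `CauchyAtHeights`, and the
socket `LogComparisonSocket.stubBody_of_rep_of_cauchy` (p452026); L < 7: STUB 4′ verbatim. [cite: King1986, Thm 3.4 (3.9) p.656] -/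
theorem logComparisonRegPrL :
    ∀ (L : ℕ), Odd L → 1 < L → ∃ (b₁ p₁ : ℝ), ∀ (b₀ p₀ : ℝ), b₁ ≤ b₀ → p₁ ≤ p₀ → 0 < b₀ → 2 < p₀ →
      ∃ ε₁ : ℝ, 0 < ε₁ ∧ ∀ (ε₀ : ℝ), 0 < ε₀ → ε₀ ≤ ε₁ → ∃ m₀ : ℕ, ∀ (m : ℕ), m₀ ≤ m →
        ∃ γ₁ : ℝ, 0 < γ₁ ∧ ∀ (F : T3Family) (γ : ℝ), F.L = L → 0 < γ → γ ≤ γ₁ →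
          ∃ (r κ : ℕ → ℝ), Summable r ∧ (∀ K, 0 ≤ r K) ∧
            ∀ K, ∀ᵐ V ∂fieldMeasure (F.P (K / m)) 0 (Matrix.specialUnitaryGroup (Fin 2) ℂ),
              PlaqSmall (θBal F.L γ b₀ p₀ (K / m)) V →
                0 < heightDensity F γ (Nat.div_le_self K m) (histGood F ℰp (θBal F.L γ b₀ p₀) K (K / m)) V →
                0 < heightDensity F γ ((Nat.div_le_self K m).trans (Nat.le_succ K))
                      (histGood F ℰp (θBal F.L γ b₀ p₀) (K + 1) (K / m)) V →
                  |(Real.log (heightDensity F γ ((Nat.div_le_self K m).trans (Nat.le_succ K))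
                        (histGood F ℰp (θBal F.L γ b₀ p₀) (K + 1) (K / m)) V) + bgRegPr' F γ m ε₀ K V) -
                    (Real.log (heightDensity F γ (Nat.div_le_self K m) (histGood F ℰp (θBal F.L γ b₀ p₀) K (K / m)) V) + bgRegPr F γ m ε₀ K V) -
                      κ K| ≤ r K := by
  intro L hLo hL
  by_cases h7 : 7 ≤ L
  swap
  · exact stub_logComparisonSmallBlocks L hLo hL (not_le.mp h7)
  obtain ⟨b₁, p₁, hrec⟩ := stub_laneRecords L hLo hL
  refine ⟨b₁, p₁, fun b₀ p₀ hb1 hp1 hb hp => ?_⟩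
  obtain ⟨𝔠, a₀, a₁, hcb, hcp, ha0, ha1, hw, h𝔠⟩ := hrec b₀ p₀ hb1 hp1
  subst hcb
  subst hcp
  obtain ⟨εa, hεa, a, ha, hA⟩ := stub_alphaTwoRunOfLane L hLo h7 𝔠 a₀ a₁ ha0 ha1 hw
  obtain ⟨εs, hεs, hS⟩ := landed_levelCauchyOfTwoRunMin L hLo hL a ha
  refine ⟨min εa εs, lt_min hεa hεs, fun ε₀ h0 h1 => ?_⟩
  have h1a : ε₀ ≤ εa := h1.trans (min_le_left _ _)
  have h1s : ε₀ ≤ εs := h1.trans (min_le_right _ _)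
  obtain ⟨m₀, hm₀⟩ := hS ε₀ h0 h1s
  refine ⟨max m₀ 1, fun m hm => ?_⟩
  have hmpos : 0 < m := Nat.lt_of_lt_of_le Nat.one_pos ((le_max_right _ _).trans hm)
  obtain ⟨γa, hγa, hA'⟩ := hA ε₀ h0 h1a
  obtain ⟨γs, hγs, hS'⟩ := hm₀ m ((le_max_left _ _).trans hm) 𝔠.b₀ 𝔠.p₀ hb hp
  refine ⟨min γa γs, lt_min hγa hγs, fun F γ hF hγ hγ₁ => ?_⟩
  have hγa' : γ ≤ γa := hγ₁.trans (min_le_left _ _)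
  have hγs' : γ ≤ γs := hγ₁.trans (min_le_right _ _)
  obtain ⟨D, hRep, hDec, hTwo⟩ := hA' F γ hF hγ hγa' (h𝔠 F hF)
  have hCau : CauchyAtHeights D 𝔠.b₀ 𝔠.p₀ m := hS' F γ hF hγ hγs' D hDec hTwo
  exact Summit.QuantumFields.YangMills.Theorems.LogComparisonSocket.stubBody_of_rep_of_cauchy F γ 𝔠.b₀ 𝔠.p₀ ε₀ hmpos
    D.PintH D.EcstH D.RmH hRep hCau

/-- The old registered `stub_posOnSmall` (birth 04793f26c2da46ec), now a THEOREM modulo stub 1 ALONE (statement verbatim; «Lemma B» landed). -/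
theorem posOnSmall :
    ∀ (L m : ℕ), 0 < m → ∀ (b₀ p₀ : ℝ), 0 < b₀ → 2 < p₀ → ∃ γ₁ : ℝ, 0 < γ₁ ∧
      ∀ (F : T3Family) (γ : ℝ), F.L = L → 0 < γ → γ ≤ γ₁ →
        ∀ K, ∀ᵐ V ∂fieldMeasure (F.P (K / m)) 0 (Matrix.specialUnitaryGroup (Fin 2) ℂ),
          PlaqSmall (θBal F.L γ b₀ p₀ (K / m)) V →
            0 < heightDensity F γ (Nat.div_le_self K m) (histGood F ℰp (θBal F.L γ b₀ p₀) K (K / m)) V ∧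
            0 < heightDensity F γ ((Nat.div_le_self K m).trans (Nat.le_succ K))
                  (histGood F ℰp (θBal F.L γ b₀ p₀) (K + 1) (K / m)) V :=
  Summit.QuantumFields.YangMills.Theorems.PosOnSmallReduction.posOnSmall_of_smallLift_of_oneStepSubmersion
    stub_oneStepSmallLift landed_oneStepSubmersion

/-- **`FluctuationComparisonRegPrL ⇐ stub_oneStepSmallLift ∧ stub_laneRecords ∧ stub_alphaTwoRunOfLane ∧ stub_logComparisonSmallBlocks`** — the NEW
load-bearing item stmt-QuantumFields-19935 BY NAME (S-E″ landed p479105/p479478; positivity via p446430 ∘ p443013 ∘ p428548; socket p452026). -/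
theorem FluctuationComparisonRegPrL_of : Summit.QuantumFields.YangMills.Theses.UnitScaleTilt.FluctuationComparisonRegPrL := by
  intro L
  by_cases hL : Odd L ∧ 1 < L
  · obtain ⟨b₁, p₁, hT⟩ := logComparisonRegPrL L hL.1 hL.2
    refine ⟨b₁, p₁, fun b₀ p₀ hb1 hp1 hb hp => ?_⟩
    obtain ⟨ε₁, hε₁, hε⟩ := hT b₀ p₀ hb1 hp1 hb hp
    refine ⟨ε₁, hε₁, fun ε₀ h0 h1 => ?_⟩
    obtain ⟨m₀, hm₀⟩ := hε ε₀ h0 h1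
    refine ⟨max m₀ 1, fun m hm => ?_⟩
    have hm₀' : m₀ ≤ m := (le_max_left _ _).trans hm
    have hmpos : 0 < m := Nat.lt_of_lt_of_le Nat.one_pos ((le_max_right _ _).trans hm)
    obtain ⟨γa, hγa, ha⟩ := posOnSmall L m hmpos b₀ p₀ hb hp
    obtain ⟨γb, hγb, hb'⟩ := hm₀ m hm₀'
    refine ⟨min γa γb, lt_min hγa hγb, fun F γ hFL hγ hγ₁ => ?_⟩
    have hP := ha F γ hFL hγ (hγ₁.trans (min_le_left _ _))
    obtain ⟨r, κ, hr, hr0, hC⟩ := hb' F γ hFL hγ (hγ₁.trans (min_le_right _ _))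
    refine ⟨r, κ, hr, hr0, fun K => ?_⟩
    filter_upwards [hP K, hC K] with V hVp hVc
    intro hs
    obtain ⟨h0', h1'⟩ := hVp hs
    exact ⟨h0', h1', hVc hs h0' h1'⟩
  · refine ⟨0, 0, fun b₀ p₀ _ _ _ _ => ⟨1, one_pos, fun ε₀ _ _ => ⟨0, fun m _ => ⟨1, one_pos, fun F γ hFL _ _ => ?_⟩⟩⟩⟩
    have hF := F.hL
    rw [hFL] at hF
    exact (hL hF).elim

end Summit.QuantumFields.YangMills.Cruxes.FluctuationComparisonRegPrL.BirthV5h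

end
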